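import Mathlib
import HarnessLib
import Summits.SmoothPoincare4.SmoothPoincare4.Theses.QuaternionicSimilarity

/-!
# DRAFT birth skeleton (BC3) for the REPAIRED crux `QuaternionicSimilarity.Straighten` (stmt-SmoothPoincare4-6271)

Status: DRAFT, NOT REGISTRABLE YET (planner-skel-stmt-SmoothPoincare4-6271-0, 2026-08-17). The crux AS TYPED is
false (`bc/T2_notStraighten.lean`, sorry-free `not_straighten : ¬ Straighten`: the fibre clause elaborates in
`Set ℝ⁸` as `Subtype.val '' (p ⁻¹' {p x}) = ↑V`, unsatisfiable since `0 ∈ V`), so no consistent stub set can give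
`Straighten_of : … → Straighten`. This file is the skeleton the registrar WOULD file once the route restates the
crux with the repaired fibre clause (class misstated; C′ = `StraightenR` below, the clause typed in `Set ↥S⁷`):
after `ledger route edit … --restate Straighten --statement '<body of StraightenR>'` (or a new item `StraightenR`),
replace `StraightenR` by the route decl and publish as `Lines/birth.lean`.

THE LINE = the route's own foreseen glued split (route header, TWO-LAYER PLAN: "Straighten ⇐ FatKaluzaKlein →
EquivariantRounding → Straighten"):

* `stub_fatKaluzaKlein` = the route crux `FatKaluzaKlein` (stmt-SmoothPoincare4-6273, rank 4) BY NAME: for every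
  homotopy 4-sphere Σ, a free smooth `Sp(1)`-action on the standard `S⁷` whose orbit map is a surjective submersion
  onto Σ, plus an `Sp(1)`-invariant Riemannian metric on `S⁷` with positive curvature operator. OPEN (the engine;
  why it might fail: O'Neill forces the quotient metric strongly positive — may be route PIC's crux in disguise).
  [BohmWilking2008] [Weinstein1980] [DerdzinskiRigas1981]
* `stub_equivariantRounding` = EQUIVARIANT ROUNDING: the data of `FatKaluzaKlein` at Σ ⇒ a great-3-sphere
  fibration of `S⁷` over Σ (the conclusion of the repaired crux at Σ). Why true (known mathematics, size XL in
  Lean): Böhm–Wilking 2008 Thm 1 — the normalised Ricci flow of a PCO metric on compact `S⁷` converges to constant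
  curvature and preserves `Isom(g₀) ⊇ Sp(1)`; a simply connected compact constant-curvature 7-manifold is isometric
  to the round `S⁷` (Hopf–Killing); a free ISOMETRIC `Sp(1)`-action on round `S⁷` is a fixed-point-free orthogonal
  representation on `ℝ⁸ = ℍ²`, conjugate in `O(8)` to left multiplication (Wolf, Spaces of constant curvature,
  §7.5), whose orbits are `S⁷ ∩ (ℍ·v)`, great 3-spheres; transporting `p` along the isometry gives `p'` with
  great-sphere fibres, still a smooth surjective submersion onto Σ. [BohmWilking2008, Thm 1] [Wolf, §7.5]
* `straightenR_of_stubs : FatKaluzaKlein → <stub₂-sig> → StraightenR` — the real composition (sorry-free): fix Σ,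
  supply `Fact (finrank ℝ ℍ = 3 + 1)` (`Quaternion.finrank_eq_four`), feed stub 1 at Σ into stub 2 at Σ.
* `StraightenR_of : StraightenR := straightenR_of_stubs stub_fatKaluzaKlein stub_equivariantRounding`.

`sorry` occurs ONLY in the two `stub_*` theorems. BC3 probes (`bc/probes_StraightenR.lean`): for each stub `X`,
`X → StraightenR` and `X → SmoothPoincare4` by `first | exact? | simpa | aesop` — all four FAIL (recorded in the
registrar's NOTES.md and the memo `SkelRegistrar-BLOCKED.md` in this crux directory).

Disproof used: no `Disproof.lean` / `Negative/` lemma exists for this crux (`ledger crux ls`, 2026-08-17); the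
item evidence `VacuityCheck.lean` (idea-node g12) and `T2_notStraighten.lean` (this seat) are honoured by stating
every fibre clause in `Set ↥S⁷`. `ledger negatives --problem SmoothPoincare4`: nothing on S⁷ / Sp(1)-actions.
-/

-- `Summit.<Summit>.<Problem>`: single-conjunct summit, the duplicate component is mandated (CONVENTIONS §2).
set_option linter.dupNamespace false
set_option linter.unusedVariables false

noncomputable section

namespace Summit.SmoothPoincare4.SmoothPoincare4.Cruxes.Straighten.BirthDraft

open scoped Manifold ContDiff Topology
open Summit.SmoothPoincare4.SmoothPoincare4.Theses.QuaternionicSimilarity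

/-- **C′ — the repaired crux statement** (to be filed by the route's planner; identical to `Straighten` except
that the fibre clause is an equation in `Set ↥S⁷`): for every homotopy 4-sphere Σ there is a smooth surjective
submersion `p : S⁷ → Σ` each of whose fibres `p ⁻¹' {p x}` is `{y ∈ S⁷ | ↑y ∈ V}` for a 4-dimensional linear
subspace `V ⊆ ℝ⁸` (a fibration of the standard `S⁷` by great 3-spheres with base Σ). [Yang1981] [GluckWarnerYang1983] -/
def StraightenR : Prop :=
  ∀ S : Literature.Topology.FourManifolds.HomotopySphere 4,
    ∃ p : Metric.sphere (0 : EuclideanSpace ℝ (Fin 8)) 1 → S.carrier,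
      ContMDiff (𝓡 7) (𝓡 4) ∞ p ∧ Function.Surjective p ∧
      (∀ x, Function.Surjective (mfderiv (𝓡 7) (𝓡 4) p x)) ∧
      ∀ x, ∃ V : Submodule ℝ (EuclideanSpace ℝ (Fin 8)), Module.finrank ℝ V = 4 ∧
        p ⁻¹' {p x} = {y : Metric.sphere (0 : EuclideanSpace ℝ (Fin 8)) 1 | (y : EuclideanSpace ℝ (Fin 8)) ∈ V}

/-! ## The two stubs -/

/-- **Stub 1 `stub_fatKaluzaKlein` — FAT KALUZA–KLEIN** = the route crux `FatKaluzaKlein`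
(stmt-SmoothPoincare4-6273) by name. OPEN. [BohmWilking2008] [Weinstein1980] [DerdzinskiRigas1981] -/
theorem stub_fatKaluzaKlein : FatKaluzaKlein := by
  sorry

/-- **Stub 2 `stub_equivariantRounding` — EQUIVARIANT ROUNDING.** For every homotopy 4-sphere Σ: a free smooth
`Sp(1)`-action on the standard `S⁷` whose orbit map `p` is a smooth surjective submersion onto Σ, together with an
`Sp(1)`-invariant Riemannian metric of positive curvature operator on `S⁷` (the data of `FatKaluzaKlein` at Σ,
verbatim), yields a smooth surjective submersion `S⁷ → Σ` all of whose fibres are great 3-spheres. Known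
mathematics (Böhm–Wilking equivariant convergence to the round metric + Hopf–Killing + linear rigidity of free
orthogonal `Sp(1)`-actions on `ℝ⁸`); size XL. [BohmWilking2008, Thm 1] [Wolf, Spaces of constant curvature, §7.5] -/
theorem stub_equivariantRounding :
    ∀ [Fact (Module.finrank ℝ (Quaternion ℝ) = 3 + 1)] (S : Literature.Topology.FourManifolds.HomotopySphere 4),
      (∃ (_ : MulAction (Metric.sphere (0 : Quaternion ℝ) 1) (Metric.sphere (0 : EuclideanSpace ℝ (Fin 8)) 1))
          (p : Metric.sphere (0 : EuclideanSpace ℝ (Fin 8)) 1 → S.carrier)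
          (g : Literature.Geometry.Lorentzian.PseudoRiemannianMetric (𝓡 7) ∞ (EuclideanSpace ℝ (Fin 7))
            (TangentSpace (𝓡 7) : Metric.sphere (0 : EuclideanSpace ℝ (Fin 8)) 1 → Type _)),
        ContMDiffSMul (𝓡 3) (𝓡 7) ∞ (Metric.sphere (0 : Quaternion ℝ) 1) (Metric.sphere (0 : EuclideanSpace ℝ (Fin 8)) 1) ∧
        (∀ (q : Metric.sphere (0 : Quaternion ℝ) 1) (x : Metric.sphere (0 : EuclideanSpace ℝ (Fin 8)) 1), q • x = x → q = 1) ∧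
        ContMDiff (𝓡 7) (𝓡 4) ∞ p ∧ Function.Surjective p ∧
        (∀ x, Function.Surjective (mfderiv (𝓡 7) (𝓡 4) p x)) ∧
        (∀ x y, p x = p y ↔ ∃ q : Metric.sphere (0 : Quaternion ℝ) 1, q • x = y) ∧
        g.IsRiemannian ∧ g.HasPositiveCurvatureOperator ∧
        ∀ q : Metric.sphere (0 : Quaternion ℝ) 1,
          Literature.Geometry.Lorentzian.PseudoRiemannianMetric.IsIsometricImmersion g g
            (fun x : Metric.sphere (0 : EuclideanSpace ℝ (Fin 8)) 1 => q • x)) →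
      ∃ p : Metric.sphere (0 : EuclideanSpace ℝ (Fin 8)) 1 → S.carrier,
        ContMDiff (𝓡 7) (𝓡 4) ∞ p ∧ Function.Surjective p ∧
        (∀ x, Function.Surjective (mfderiv (𝓡 7) (𝓡 4) p x)) ∧
        ∀ x, ∃ V : Submodule ℝ (EuclideanSpace ℝ (Fin 8)), Module.finrank ℝ V = 4 ∧
          p ⁻¹' {p x} = {y : Metric.sphere (0 : EuclideanSpace ℝ (Fin 8)) 1 | (y : EuclideanSpace ℝ (Fin 8)) ∈ V} := by
  sorry

/-! ## The composition (sorry-free) -/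

/-- `dim_ℝ ℍ = 3 + 1`, the `Fact` under which `Sp(1) = Metric.sphere (0 : ℍ) 1` carries its 3-sphere charts
(`EuclideanSpace.instChartedSpaceSphere`). [folklore] -/
instance factFinrankQuaternion : Fact (Module.finrank ℝ (Quaternion ℝ) = 3 + 1) :=
  ⟨by rw [Quaternion.finrank_eq_four]⟩

/-- **The real composition**: `FatKaluzaKlein → EquivariantRounding → StraightenR`, pointwise in Σ. [folklore] -/
theorem straightenR_of_stubs (h₁ : FatKaluzaKlein)
    (h₂ : ∀ [Fact (Module.finrank ℝ (Quaternion ℝ) = 3 + 1)] (S : Literature.Topology.FourManifolds.HomotopySphere 4),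
      (∃ (_ : MulAction (Metric.sphere (0 : Quaternion ℝ) 1) (Metric.sphere (0 : EuclideanSpace ℝ (Fin 8)) 1))
          (p : Metric.sphere (0 : EuclideanSpace ℝ (Fin 8)) 1 → S.carrier)
          (g : Literature.Geometry.Lorentzian.PseudoRiemannianMetric (𝓡 7) ∞ (EuclideanSpace ℝ (Fin 7))
            (TangentSpace (𝓡 7) : Metric.sphere (0 : EuclideanSpace ℝ (Fin 8)) 1 → Type _)),
        ContMDiffSMul (𝓡 3) (𝓡 7) ∞ (Metric.sphere (0 : Quaternion ℝ) 1) (Metric.sphere (0 : EuclideanSpace ℝ (Fin 8)) 1) ∧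
        (∀ (q : Metric.sphere (0 : Quaternion ℝ) 1) (x : Metric.sphere (0 : EuclideanSpace ℝ (Fin 8)) 1), q • x = x → q = 1) ∧
        ContMDiff (𝓡 7) (𝓡 4) ∞ p ∧ Function.Surjective p ∧
        (∀ x, Function.Surjective (mfderiv (𝓡 7) (𝓡 4) p x)) ∧
        (∀ x y, p x = p y ↔ ∃ q : Metric.sphere (0 : Quaternion ℝ) 1, q • x = y) ∧
        g.IsRiemannian ∧ g.HasPositiveCurvatureOperator ∧
        ∀ q : Metric.sphere (0 : Quaternion ℝ) 1,
          Literature.Geometry.Lorentzian.PseudoRiemannianMetric.IsIsometricImmersion g g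
            (fun x : Metric.sphere (0 : EuclideanSpace ℝ (Fin 8)) 1 => q • x)) →
      ∃ p : Metric.sphere (0 : EuclideanSpace ℝ (Fin 8)) 1 → S.carrier,
        ContMDiff (𝓡 7) (𝓡 4) ∞ p ∧ Function.Surjective p ∧
        (∀ x, Function.Surjective (mfderiv (𝓡 7) (𝓡 4) p x)) ∧
        ∀ x, ∃ V : Submodule ℝ (EuclideanSpace ℝ (Fin 8)), Module.finrank ℝ V = 4 ∧
          p ⁻¹' {p x} = {y : Metric.sphere (0 : EuclideanSpace ℝ (Fin 8)) 1 | (y : EuclideanSpace ℝ (Fin 8)) ∈ V}) :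
    StraightenR :=
  fun S => h₂ S (h₁ S)

/-- **THE SKELETON THEOREM (draft)**: the repaired crux `StraightenR`, closed modulo the two stubs
(D-0027 §3.3 shape). After the restate, retarget to the route decl by name. [folklore] -/
theorem StraightenR_of : StraightenR :=
  straightenR_of_stubs stub_fatKaluzaKlein stub_equivariantRounding

/-- Sanity: the repaired statement differs from the crux as typed only in the fibre clause; in particular the
model case is no longer excluded — the clause `p ⁻¹' {p x} = {y | ↑y ∈ V}` is now an equation of subsets of `S⁷`. -/
example (p : Metric.sphere (0 : EuclideanSpace ℝ (Fin 8)) 1 → Metric.sphere (0 : EuclideanSpace ℝ (Fin 5)) 1)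
    (x : Metric.sphere (0 : EuclideanSpace ℝ (Fin 8)) 1) (V : Submodule ℝ (EuclideanSpace ℝ (Fin 8))) :
    (p ⁻¹' {p x} = {y : Metric.sphere (0 : EuclideanSpace ℝ (Fin 8)) 1 | (y : EuclideanSpace ℝ (Fin 8)) ∈ V}) ↔
      ∀ y : Metric.sphere (0 : EuclideanSpace ℝ (Fin 8)) 1, p y = p x ↔ (y : EuclideanSpace ℝ (Fin 8)) ∈ V := by
  simp [Set.ext_iff]

end Summit.SmoothPoincare4.SmoothPoincare4.Cruxes.Straighten.BirthDraft
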